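import Mathlib
import Summits.Ventures.HodgeRepro2.T5CompletionDegree
import Summits.Ventures.HodgeRepro2.T5GaussianField
import Summits.Ventures.HodgeRepro2.T5WildConductor

/-!
# A CONCRETE RAMIFIED PLACE: `ℚ(ζ₄)/ℚ` at `2` — the hypotheses of the ramified chain hold, and `f(η_v) = 2`
(T5GaussianPlace)

`K = ℚ`, `L = ℚ(ζ₄) = ℚ(i)` (T5GaussianField), `v = v₂` the place of `ℚ` at `2`, `w` ANY place of `L` above `v₂`
(one exists: `exists_liesOver`). On Mathlib's completions `K_v ⊆ L_w` (the canonical algebra of row 79):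
* `[L_w : K_v] = 2` (`finrank_eq_two`: T5CompletionDegree + `−1` not a square in `ℚ₂`);
* `ϖ = 2` is a uniformiser of `O_{K_v}` (`irreducible_two`), `π = 1 + ζ` is a uniformiser of `O_{L_w}`
  (`irreducible_pi`), and `2 = ζ³ π²` is NOT irreducible in `O_{L_w}` (`not_irreducible_algebraMap_two`):
  the place is RAMIFIED (wild: residue characteristic `2`);
* there is `σ ≠ 1` in `Gal(L_w/K_v)`, and every such `σ` sends `ζ ↦ −ζ` (`algEquiv_zeta`), so
  `σ π − π = −2ζ` has valuation `exp(−2)`;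
* hence THE CONDUCTOR EXPONENT of the norm character `η_v` of `L_w/K_v` is `f(η_v) = 2` (`normCharConductor_eq_two`:
  row 176's `f(η_v) = v_E(σπ − π)`) — the classical conductor of `ℚ₂(i)/ℚ₂` (discriminant `−4 = 2²`) — and the
  route's (iv-a) produces a conjugate-symplectic character of conductor EXACTLY `2·1 + 1 = 3`
  (`exists_CS_conductor_eq_three`).
This is the §10.5(ii)(c)/(d) witness for the hypothesis set of rows 169–177 (and of the per-place statements
of Theorem N5.T2 built on the same carriers): the hypotheses `h2 hϖ hπ hram hσ` are SATISFIABLE on a concrete pair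
of number fields and places inside Mathlib, with the conductor computed in kernel.

No axiom beyond the standard trio; nothing of the scored record changes.
§8(d): uses an L-value-free non-vanishing device: NO.
-/

namespace Summit.Ventures.HodgeRepro2.T5GaussianPlace

open IsDedekindDomain HeightOneSpectrum NumberField
open Summit.Ventures.HodgeRepro2.T5GaussianField

/-! ### The place `v₂` of `ℚ` and a place `w` of `ℚ(ζ₄)` above it -/

/-- `v₂.asIdeal = (2)` in `𝓞 ℚ`. -/
theorem asIdeal_v₂ : v₂.asIdeal = Ideal.span {(2 : NumberField.RingOfIntegers ℚ)} := by
  unfold v₂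
  simp only [Rat.HeightOneSpectrum.primesEquiv, Equiv.coe_fn_symm_mk,
    IsDedekindDomain.HeightOneSpectrum.ofPrime_asIdeal, Ideal.map_span, Set.image_singleton]
  congr 2
  exact map_ofNat _ 2

/-- `2 ∈ v₂`. -/
theorem two_mem_v₂ : (2 : NumberField.RingOfIntegers ℚ) ∈ v₂.asIdeal := by
  rw [asIdeal_v₂]
  exact Ideal.mem_span_singleton_self 2

/-- Some place `w` of `ℚ(ζ₄)` lies over `v₂`. -/
theorem exists_liesOver : ∃ w : HeightOneSpectrum (NumberField.RingOfIntegers L), w.asIdeal.LiesOver v₂.asIdeal := by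
  haveI : v₂.asIdeal.IsMaximal := v₂.isMaximal
  obtain ⟨Q, hQmax, hQ⟩ := Ideal.exists_ideal_over_maximal_of_isIntegral
    (S := NumberField.RingOfIntegers L) v₂.asIdeal
    (by
      rw [(RingHom.injective_iff_ker_eq_bot (algebraMap (NumberField.RingOfIntegers ℚ)
        (NumberField.RingOfIntegers L))).mp (FaithfulSMul.algebraMap_injective _ _)]
      exact bot_le)
  haveI := hQmax
  refine ⟨⟨Q, hQmax.isPrime, ?_⟩, ⟨?_⟩⟩
  · rintro rfl
    rw [Ideal.comap_bot_of_injective _ (FaithfulSMul.algebraMap_injective _ _)] at hQ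
    exact v₂.ne_bot hQ.symm
  · exact hQ.symm

variable (w : HeightOneSpectrum (NumberField.RingOfIntegers L)) [w.asIdeal.LiesOver v₂.asIdeal]

/-- `2 ∈ w`. -/
theorem two_mem_w : (2 : NumberField.RingOfIntegers L) ∈ w.asIdeal := by
  have h : v₂.asIdeal ≤ Ideal.under (NumberField.RingOfIntegers ℚ) w.asIdeal :=
    (Ideal.LiesOver.over (P := w.asIdeal) (p := v₂.asIdeal)).le
  have h2 := h two_mem_v₂
  rw [Ideal.mem_comap, map_ofNat] at h2
  exact h2

/-- `1 + ζ ∈ w` (its square `2ζ` is in `w`). -/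
theorem one_add_zetaO_mem_w : 1 + ζO ∈ w.asIdeal := by
  apply w.isPrime.mem_of_pow_mem 2
  rw [one_add_zetaO_sq]
  exact Ideal.mul_mem_right _ _ (two_mem_w w)

/-! ### `[L_w : K_v] = 2` -/

omit [w.asIdeal.LiesOver v₂.asIdeal] in
/-- The image of `ζ` in `L_w` squares to `−1`. -/
theorem zeta_completion_sq : (algebraMap L (w.adicCompletion L) ζ) ^ 2 = -1 := by
  rw [← map_pow, zeta_sq, map_neg, map_one]

/-- `[L_w : K_v] = 2`. -/
theorem finrank_eq_two :
    Module.finrank (v₂.adicCompletion ℚ) (w.adicCompletion L) = 2 :=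
  T5CompletionDegree.finrank_eq_two v₂ w T5GaussianField.finrank_eq_two
    (T5CompletionDegree.notMem_range_of_sq_eq_neg_one v₂ w not_exists_sq_eq_neg_one (zeta_completion_sq w))

/-! ### The uniformisers `ϖ = 2` of `K_v` and `π = 1 + ζ` of `L_w`; ramification -/

/-- `v(2) = exp(−1)` in `K_{v₂}`. -/
theorem val_two : Valued.v (2 : v₂.adicCompletion ℚ) = WithZero.exp (-1) := by
  have e := IsDedekindDomain.HeightOneSpectrum.valuedAdicCompletion_eq_valuation (K := ℚ) v₂
    (2 : NumberField.RingOfIntegers ℚ)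
  rw [IsDedekindDomain.HeightOneSpectrum.valuation_of_algebraMap,
    IsDedekindDomain.HeightOneSpectrum.intValuation_singleton v₂ two_ne_zero asIdeal_v₂] at e
  simp only [Algebra.cast, map_ofNat] at e
  exact e

/-- `ϖ = 2` is a uniformiser of `O_{K_{v₂}}`. -/
theorem irreducible_two : Irreducible (2 : v₂.adicCompletionIntegers ℚ) :=
  (Summit.Ventures.HodgeRepro2.T5AdicCompletionConductor.irreducible_iff_val_eq_exp_neg_one v₂
    (2 : v₂.adicCompletionIntegers ℚ)).mpr val_two

/-- The image of `1 + ζ` in `O_{L_w}`. -/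
noncomputable def π : w.adicCompletionIntegers L :=
  algebraMap (NumberField.RingOfIntegers L) (w.adicCompletionIntegers L) (1 + ζO)

/-- The image of `ζ` in `O_{L_w}`. -/
noncomputable def ζw : w.adicCompletionIntegers L :=
  algebraMap (NumberField.RingOfIntegers L) (w.adicCompletionIntegers L) ζO

omit [w.asIdeal.LiesOver v₂.asIdeal] in
/-- `ζ_w · ζ_w³ = 1`: `ζ_w` is a unit of `O_{L_w}`. -/
theorem zetaw_mul_zetaw_pow_three : ζw w * ζw w ^ 3 = 1 := by
  unfold ζw
  rw [← map_pow, ← map_mul, zetaO_mul_zetaO_pow_three, map_one]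

omit [w.asIdeal.LiesOver v₂.asIdeal] in
/-- `IsUnit ζ_w`. -/
theorem isUnit_zetaw : IsUnit (ζw w) :=
  isUnit_iff_exists_inv.mpr ⟨_, zetaw_mul_zetaw_pow_three w⟩

omit [w.asIdeal.LiesOver v₂.asIdeal] in
/-- `2 = ζ_w³ · π²` in `O_{L_w}`. -/
theorem two_eq_zetaw_pow_three_mul_pi_sq : (2 : w.adicCompletionIntegers L) = ζw w ^ 3 * π w ^ 2 := by
  unfold ζw π
  rw [← map_pow, ← map_pow, ← map_mul, one_add_zetaO_sq]
  have : ζO ^ 3 * (2 * ζO) = 2 := by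
    calc ζO ^ 3 * (2 * ζO) = 2 * (ζO * ζO ^ 3) := by ring
      _ = 2 := by rw [zetaO_mul_zetaO_pow_three, mul_one]
  rw [this, map_ofNat]

omit [w.asIdeal.LiesOver v₂.asIdeal] in
/-- The valuation of `π` in `L_w` is the `w`-adic valuation of `1 + ζ`. -/
theorem val_pi : Valued.v (π w : w.adicCompletion L) = w.intValuation (1 + ζO) := by
  have h := IsDedekindDomain.HeightOneSpectrum.valuedAdicCompletion_eq_valuation (K := L) w (1 + ζO)
  rw [IsDedekindDomain.HeightOneSpectrum.valuation_of_algebraMap] at h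
  rw [← h]
  rfl

/-- `v(π) < 1`: `π` is not a unit of `O_{L_w}`. -/
theorem val_pi_lt_one : Valued.v (π w : w.adicCompletion L) < 1 := by
  rw [val_pi, IsDedekindDomain.HeightOneSpectrum.intValuation_lt_one_iff_mem]
  exact one_add_zetaO_mem_w w

/-- `π` is not a unit of `O_{L_w}`. -/
theorem not_isUnit_pi : ¬ IsUnit (π w) := by
  intro h
  have := Summit.Ventures.HodgeRepro2.T5AdicCompletionHenselian.val_coe_units_eq_one w h.unit
  rw [IsUnit.unit_spec] at this
  exact absurd this (ne_of_lt (val_pi_lt_one w))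

/-- RAMIFICATION: `ϖ = 2` is not irreducible in `O_{L_w}` (`2 = (ζ_w³ π) · π` with `π` a non-unit). -/
theorem not_irreducible_algebraMap_two :
    ¬ Irreducible (algebraMap (v₂.adicCompletionIntegers ℚ) (w.adicCompletionIntegers L)
      (2 : v₂.adicCompletionIntegers ℚ)) := by
  intro hirr
  rw [map_ofNat] at hirr
  have h2 : (2 : w.adicCompletionIntegers L) = (ζw w ^ 3 * π w) * π w := by
    rw [two_eq_zetaw_pow_three_mul_pi_sq]
    ring
  rcases hirr.isUnit_or_isUnit h2 with h | h
  · exact not_isUnit_pi w (isUnit_of_mul_isUnit_right h)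
  · exact not_isUnit_pi w h

/-- `π` is a uniformiser of `O_{L_w}`: `v(π)² = v(2 : L_w) = v(2 : K_v)² = exp(−1)²` (the place is ramified, so
`v(alg x) = v(x)²`), hence `v(π) = exp(−1)`. -/
theorem val_pi_eq : Valued.v (π w : w.adicCompletion L) = WithZero.exp (-1) := by
  obtain ⟨π₀, hπ₀⟩ := Summit.Ventures.HodgeRepro2.T5LocalNormIndex.exists_irreducible_adicCompletionIntegers w
  have hsq := Summit.Ventures.HodgeRepro2.T5RamifiedNormTransfer.val_algebraMap_eq_sq v₂ w (finrank_eq_two w)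
    irreducible_two hπ₀ (not_irreducible_algebraMap_two w) (2 : v₂.adicCompletion ℚ)
  rw [map_ofNat, val_two] at hsq
  -- `v(2 : L_w) = v(ζ_w)³ · v(π)² = v(π)²`
  have hζ : Valued.v (ζw w : w.adicCompletion L) = 1 := by
    have := Summit.Ventures.HodgeRepro2.T5AdicCompletionHenselian.val_coe_units_eq_one w (isUnit_zetaw w).unit
    rwa [IsUnit.unit_spec] at this
  have h2 : Valued.v ((2 : w.adicCompletionIntegers L) : w.adicCompletion L) =
      Valued.v (π w : w.adicCompletion L) ^ 2 := by
    rw [two_eq_zetaw_pow_three_mul_pi_sq]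
    push_cast
    rw [map_mul, map_pow, map_pow, hζ, one_pow, one_mul]
  have h2' : ((2 : w.adicCompletionIntegers L) : w.adicCompletion L) = 2 := rfl
  rw [h2', hsq] at h2
  -- `exp(−1)² = v(π)²` with `v(π) ≠ 0`
  have hne : Valued.v (π w : w.adicCompletion L) ≠ 0 := by
    rw [Valuation.ne_zero_iff]
    intro h0
    have : (2 : w.adicCompletion L) = 0 := by
      rw [← h2', two_eq_zetaw_pow_three_mul_pi_sq]
      push_cast
      rw [h0]
      ring
    exact two_ne_zero this
  obtain ⟨k, hk⟩ : ∃ k : ℤ, Valued.v (π w : w.adicCompletion L) = WithZero.exp k :=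
    ⟨_, (WithZero.exp_log hne).symm⟩
  rw [hk, ← WithZero.exp_nsmul, ← WithZero.exp_nsmul, WithZero.exp_inj] at h2
  rw [hk]
  congr 1
  simp only [nsmul_eq_mul] at h2
  omega

/-- `π = 1 + ζ` is a uniformiser of `O_{L_w}`. -/
theorem irreducible_pi : Irreducible (π w) :=
  (Summit.Ventures.HodgeRepro2.T5AdicCompletionConductor.irreducible_iff_val_eq_exp_neg_one w (π w)).mpr
    (val_pi_eq w)

/-! ### The Galois conjugation and `σ π − π = −2ζ` -/

/-- There is a non-trivial `K_v`-automorphism of `L_w`. -/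
theorem exists_algEquiv_ne_one :
    ∃ σ : (w.adicCompletion L) ≃ₐ[v₂.adicCompletion ℚ] (w.adicCompletion L), σ ≠ 1 :=
  Summit.Ventures.HodgeRepro2.T5AdicCompletionConjugation.exists_algEquiv_ne_one v₂ w (finrank_eq_two w)

omit [w.asIdeal.LiesOver v₂.asIdeal] in
/-- `(π : L_w) = 1 + ζ_w`. -/
theorem coe_pi : (π w : w.adicCompletion L) = 1 + (ζw w : w.adicCompletion L) := by
  unfold π ζw
  rw [map_add, map_one]
  push_cast
  rfl

/-- Every non-trivial `σ ∈ Gal(L_w/K_v)` sends `ζ` to `−ζ`. -/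
theorem algEquiv_zetaw (σ : (w.adicCompletion L) ≃ₐ[v₂.adicCompletion ℚ] (w.adicCompletion L)) (hσ : σ ≠ 1) :
    σ (ζw w : w.adicCompletion L) = -(ζw w : w.adicCompletion L) := by
  have hsq : (ζw w : w.adicCompletion L) ^ 2 = -1 := by
    unfold ζw
    have : ((algebraMap (NumberField.RingOfIntegers L) (w.adicCompletionIntegers L) ζO : w.adicCompletionIntegers L) :
        w.adicCompletion L) = algebraMap L (w.adicCompletion L) ζ := rfl
    rw [this]
    exact zeta_completion_sq w
  have h : (σ (ζw w : w.adicCompletion L)) ^ 2 = ((ζw w : w.adicCompletion L)) ^ 2 := by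
    rw [← map_pow, hsq, map_neg, map_one]
  rcases sq_eq_sq_iff_eq_or_eq_neg.mp h with h | h
  · -- `σ` fixes `ζ`, hence `π`, hence everything: `σ = 1`
    exfalso
    apply hσ
    ext y
    obtain ⟨a, b, hy⟩ := Summit.Ventures.HodgeRepro2.T5RamifiedIntegralBasis.exists_eq_algebraMap_add_algebraMap_mul_uniformizer
      v₂ w (finrank_eq_two w) irreducible_two (irreducible_pi w) (not_irreducible_algebraMap_two w) y
    rw [hy, map_add, map_mul, AlgEquiv.commutes, AlgEquiv.commutes, coe_pi, map_add, map_one, h]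
    rfl
  · exact h

/-- `σ π − π = −2 ζ_w` for every non-trivial `σ`. -/
theorem algEquiv_pi_sub_pi (σ : (w.adicCompletion L) ≃ₐ[v₂.adicCompletion ℚ] (w.adicCompletion L)) (hσ : σ ≠ 1) :
    σ (π w : w.adicCompletion L) - (π w : w.adicCompletion L) = -(2 * (ζw w : w.adicCompletion L)) := by
  rw [coe_pi, map_add, map_one, algEquiv_zetaw w σ hσ]
  ring

/-- `v(σ π − π) = exp(−2)`: the ramification break of `L_w/K_v` is `t = 1`. -/
theorem val_algEquiv_pi_sub_pi (σ : (w.adicCompletion L) ≃ₐ[v₂.adicCompletion ℚ] (w.adicCompletion L))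
    (hσ : σ ≠ 1) :
    Valued.v (σ (π w : w.adicCompletion L) - (π w : w.adicCompletion L)) = WithZero.exp (-(2 : ℕ) : ℤ) := by
  rw [algEquiv_pi_sub_pi w σ hσ, Valuation.map_neg, map_mul]
  have hζ : Valued.v (ζw w : w.adicCompletion L) = 1 := by
    have := Summit.Ventures.HodgeRepro2.T5AdicCompletionHenselian.val_coe_units_eq_one w (isUnit_zetaw w).unit
    rwa [IsUnit.unit_spec] at this
  have h2 : Valued.v (2 : w.adicCompletion L) = WithZero.exp (-1) ^ 2 := by
    have hsq := Summit.Ventures.HodgeRepro2.T5RamifiedNormTransfer.val_algebraMap_eq_sq v₂ w (finrank_eq_two w)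
      irreducible_two (irreducible_pi w) (not_irreducible_algebraMap_two w) (2 : v₂.adicCompletion ℚ)
    rwa [map_ofNat, val_two] at hsq
  rw [hζ, mul_one, h2, ← WithZero.exp_nsmul]
  congr 1

/-! ### THE CONDUCTOR: `f(η_v) = 2` -/

/-- THE CONDUCTOR EXPONENT OF THE NORM CHARACTER OF `ℚ₂(i)/ℚ₂` IS `2`: for every non-trivial `σ`,
`normCharConductor v₂ w σ 2 hind = 2` (row 176's `f(η_v) = v_E(σπ − π)` with `v(σπ − π) = v(−2ζ) = exp(−2)`). -/
theorem normCharConductor_eq_two (σ : (w.adicCompletion L) ≃ₐ[v₂.adicCompletion ℚ] (w.adicCompletion L))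
    (hσ : σ ≠ 1) (hind : (Summit.Ventures.HodgeRepro2.T5AdicCompletionNormGroup.normGroup v₂ w σ).index = 2) :
    Summit.Ventures.HodgeRepro2.T5NormCharConductor.normCharConductor v₂ w σ
      (2 : v₂.adicCompletionIntegers ℚ) hind = 2 :=
  Summit.Ventures.HodgeRepro2.T5WildConductor.normCharConductor_eq_break v₂ w (finrank_eq_two w) irreducible_two
    (irreducible_pi w) (not_irreducible_algebraMap_two w) σ hσ (by norm_num) (val_algEquiv_pi_sub_pi w σ hσ) hind

/-- The index hypothesis holds: `[K_v^× : N L_w^×] = 2`. -/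
theorem index_normGroup_eq_two (σ : (w.adicCompletion L) ≃ₐ[v₂.adicCompletion ℚ] (w.adicCompletion L))
    (hσ : σ ≠ 1) : (Summit.Ventures.HodgeRepro2.T5AdicCompletionNormGroup.normGroup v₂ w σ).index = 2 :=
  Summit.Ventures.HodgeRepro2.T5LocalNormIndex.index_normGroup_eq_two v₂ w σ (finrank_eq_two w) hσ

/-- THE ROUTE'S (iv-a) AT THE CONCRETE PLACE: a conjugate-symplectic character `ω` of `L_w^×` restricting to `η_v` on
`F_v^×`, trivial on some `U_E^{(m)}`, of conductor EXACTLY `3 = 2·1 + 1`. -/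
theorem exists_CS_conductor_eq_three (σ : (w.adicCompletion L) ≃ₐ[v₂.adicCompletion ℚ] (w.adicCompletion L))
    (hσ : σ ≠ 1) :
    ∃ ω : (w.adicCompletion L)ˣ →* ℂˣ,
      (∀ f : Summit.Ventures.HodgeRepro2.T6.N5LocalInertCompletion.Fsub v₂ w,
        ω f = Summit.Ventures.HodgeRepro2.T6.N5LocalInertCompletion.ηF v₂ w σ (index_normGroup_eq_two w σ hσ) f) ∧
      (∃ m, Summit.Ventures.HodgeRepro2.T6.N5LocalRamCompletion.Uπ w (π w) m ≤ ω.ker) ∧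
      Summit.Ventures.HodgeRepro2.T5ConductorArithmetic.conductor
        (Summit.Ventures.HodgeRepro2.T6.N5LocalRamCompletion.Uπ w (π w)) ω = 3 := by
  obtain ⟨ω, h1, h2, h3⟩ := Summit.Ventures.HodgeRepro2.T5RamifiedOddConductor.exists_CS_conductor_eq v₂ w
    (finrank_eq_two w) irreducible_two (irreducible_pi w) (not_irreducible_algebraMap_two w) σ hσ
    (index_normGroup_eq_two w σ hσ)
  refine ⟨ω, h1, h2, ?_⟩
  rw [h3, normCharConductor_eq_two w σ hσ]

/-- THE HYPOTHESIS SET OF THE RAMIFIED CHAIN IS SATISFIABLE (README §10.5(ii)(c)/(d) witness): at `ℚ(ζ₄)/ℚ` and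
any `w ∣ 2`, there are uniformisers `ϖ`, `π`, the place is ramified, and `Gal(L_w/K_v)` has a non-trivial element. -/
theorem hypotheses_satisfiable :
    Module.finrank (v₂.adicCompletion ℚ) (w.adicCompletion L) = 2 ∧
    ∃ (ϖ : v₂.adicCompletionIntegers ℚ) (π' : w.adicCompletionIntegers L),
      Irreducible ϖ ∧ Irreducible π' ∧
      ¬ Irreducible (algebraMap (v₂.adicCompletionIntegers ℚ) (w.adicCompletionIntegers L) ϖ) ∧
      ∃ σ : (w.adicCompletion L) ≃ₐ[v₂.adicCompletion ℚ] (w.adicCompletion L), σ ≠ 1 :=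
  ⟨finrank_eq_two w, 2, π w, irreducible_two, irreducible_pi w, not_irreducible_algebraMap_two w,
    exists_algEquiv_ne_one w⟩

end Summit.Ventures.HodgeRepro2.T5GaussianPlace
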